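import Summits.CriticalPhenomena.SAWScalingLimit.Theses.SAWRingGibbsDescent

/-!
# Birth skeleton (BC3) of the support item `CommonPinsExist` (stmt-CriticalPhenomena-17608, route
SAWRingGibbsDescent; child 3/3 of `DomainContinuity`, line `common-pin-triangle`)

Planar topology of Jordan wall-domains + lattice approximation (no SAW). Two stubs:

* `stub_commonBulk` — deep anchor balls near the two marks lie in `W` and, eventually in `n`, in every
  `W_n` (collar tracking), and lattice sites in them are joined in BOTH graphs for `δ < δ₀` uniformly in
  `n ≥ N` (a fixed compact corridor of `W` joining the balls lies in `W_n` eventually, carries lattice paths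
  for small mesh, and belongs to the LARGEST lattice component — the bulk — of each graph);
* `stub_pinsJoinBulk` — the single-body claim: a pin pair near the two marks that is joined in the graph of
  `W_n` (resp. `W`) is joined to every site of a deep anchor ball (Fréchet convergence to a simple limit
  wall forbids a second macroscopic component; for a Jordan domain only finitely many fjords are
  macroscopic, so their necks are bounded below);
* `CommonPinsExist_of` — anchors `c := nearestSite δ c₀`, `d := nearestSite δ d₀` (within `δ < s` of the
  centres, `dist_meshPoint_nearestSite_le`), radii `s ≤ ρ/2`, balls nested `B(δc, s) ⊆ B(c₀, 2s) ⊆ B(c₀, 3s)`.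
-/

noncomputable section

namespace Summit.CriticalPhenomena.SAWScalingLimit.Cruxes.CommonPinsExist.Birth

open Filter Topology
open Summit.CriticalPhenomena.SAWScalingLimit.Theses.SAWRingGibbsDescent (CommonPinsExist)

/-- Stub 1: common deep anchor balls, joined in both graphs uniformly in `n ≥ N`, `δ < δ₀`. [folklore] -/
theorem stub_commonBulk :
    ∀ (D : Literature.Probability.RandomPlanarGeometry.DobrushinDomain), (let IsWall : Literature.Probability.RandomPlanarGeometry.CurveClass ℂ → Literature.Probability.RandomPlanarGeometry.DobrushinDomain → Prop := fun η W => W.carrier ⊆ D.carrier ∧ W.pt 0 = D.pt 0 ∧ W.pt 1 = D.pt 1 ∧ frontier W.carrier = η.range ∪ D.arc 1; ∀ (ηs : ℕ → Literature.Probability.RandomPlanarGeometry.CurveClass ℂ) (η : Literature.Probability.RandomPlanarGeometry.CurveClass ℂ) (Ws : ℕ → Literature.Probability.RandomPlanarGeometry.DobrushinDomain) (W : Literature.Probability.RandomPlanarGeometry.DobrushinDomain), (∀ n, IsWall (ηs n) (Ws n)) → IsWall η W → η ∈ Literature.Probability.RandomPlanarGeometry.CurveClass.simple → Filter.Tendsto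 ηs Filter.atTop (nhds η) → ∀ ρ > (0 : ℝ), ∃ s : ℝ, 0 < s ∧ s ≤ ρ / 2 ∧ ∃ c₀ d₀ : ℂ, dist c₀ (D.pt 0) < ρ / 2 ∧ dist d₀ (D.pt 1) < ρ / 2 ∧ ∃ N : ℕ, ∃ δ₀ : ℝ, 0 < δ₀ ∧ ∀ n ≥ N, Metric.ball c₀ (3 * s) ⊆ (Ws n).carrier ∩ W.carrier ∧ Metric.ball d₀ (3 * s) ⊆ (Ws n).carrier ∩ W.carrier ∧ ∀ δ ∈ Set.Ioo (0 : ℝ) δ₀, ∀ c d : Literature.Probability.LatticeModels.Site 2, Literature.Probability.LatticeModels.meshPoint δ c ∈ Metric.ball c₀ s → Literature.Probability.LatticeModels.meshPoint δ d ∈ Metric.ball d₀ s → (Literature.Probability.LatticeModels.discreteDomainGraph (Ws n).carrier δ).Reachable c d ∧ (Literature.Probability.LatticeModels.discreteDomainGraph W.carrier δ).Reachable c d) := by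
  sorry

/-- Stub 2: joined pin pairs near the marks are joined to the deep bulk (single macroscopic body). [folklore] -/
theorem stub_pinsJoinBulk :
    ∀ (D : Literature.Probability.RandomPlanarGeometry.DobrushinDomain), (let IsWall : Literature.Probability.RandomPlanarGeometry.CurveClass ℂ → Literature.Probability.RandomPlanarGeometry.DobrushinDomain → Prop := fun η W => W.carrier ⊆ D.carrier ∧ W.pt 0 = D.pt 0 ∧ W.pt 1 = D.pt 1 ∧ frontier W.carrier = η.range ∪ D.arc 1; ∀ (ηs : ℕ → Literature.Probability.RandomPlanarGeometry.CurveClass ℂ) (η : Literature.Probability.RandomPlanarGeometry.CurveClass ℂ) (Ws : ℕ → Literature.Probability.RandomPlanarGeometry.DobrushinDomain) (W : Literature.Probability.RandomPlanarGeometry.DobrushinDomain), (∀ n, IsWall (ηs n) (Ws n)) → IsWall η W → η ∈ Literature.Probability.RandomPlanarGeometry.CurveClass.simple → Filter.Tendsto ηs Filter.atTop (nhds η) → ∀ (c₀ : ℂ) (s : ℝ), 0 < s → (∃ N : ℕ, ∀ n ≥ N, Metric.ball c₀ (2 * s) ⊆ (Ws n).carrier ∩ W.carrier) → ∃ ρ'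 : ℝ, 0 < ρ' ∧ ∃ N : ℕ, ∃ δ₀ : ℝ, 0 < δ₀ ∧ ∀ n ≥ N, ∀ δ ∈ Set.Ioo (0 : ℝ) δ₀, ∀ x y c : Literature.Probability.LatticeModels.Site 2, dist (Literature.Probability.LatticeModels.meshPoint δ x) (D.pt 0) < ρ' → dist (Literature.Probability.LatticeModels.meshPoint δ y) (D.pt 1) < ρ' → Literature.Probability.LatticeModels.meshPoint δ c ∈ Metric.ball c₀ s → ((Literature.Probability.LatticeModels.discreteDomainGraph (Ws n).carrier δ).Reachable x y → (Literature.Probability.LatticeModels.discreteDomainGraph (Ws n).carrier δ).Reachable x c) ∧ ((Literature.Probability.LatticeModels.discreteDomainGraph W.carrier δ).Reachable x y → (Literature.Probability.LatticeModels.discreteDomainGraph W.carrier δ).Reachable x c)) := by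
  sorry

/-! ## Name-keyed aliases (hypotheses of `CommonPinsExist_of`) -/
namespace __Registered

/-- Alias of the statement of `stub_commonBulk`, keyed by the stub name. -/
abbrev stub_commonBulk : Prop :=
  ∀ (D : Literature.Probability.RandomPlanarGeometry.DobrushinDomain), (let IsWall : Literature.Probability.RandomPlanarGeometry.CurveClass ℂ → Literature.Probability.RandomPlanarGeometry.DobrushinDomain → Prop := fun η W => W.carrier ⊆ D.carrier ∧ W.pt 0 = D.pt 0 ∧ W.pt 1 = D.pt 1 ∧ frontier W.carrier = η.range ∪ D.arc 1; ∀ (ηs : ℕ → Literature.Probability.RandomPlanarGeometry.CurveClass ℂ) (η : Literature.Probability.RandomPlanarGeometry.CurveClass ℂ) (Ws : ℕ → Literature.Probability.RandomPlanarGeometry.DobrushinDomain) (W : Literature.Probability.RandomPlanarGeometry.DobrushinDomain), (∀ n, IsWall (ηs n) (Ws n)) → IsWall η W → η ∈ Literature.Probability.RandomPlanarGeometry.CurveClass.simple → Filter.Tendsto ηs Filter.atTop (nhds η) → ∀ ρ > (0 : ℝ), ∃ s : ℝ, 0 < s ∧ s ≤ ρ / 2 ∧ ∃ c₀ d₀ :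 ℂ, dist c₀ (D.pt 0) < ρ / 2 ∧ dist d₀ (D.pt 1) < ρ / 2 ∧ ∃ N : ℕ, ∃ δ₀ : ℝ, 0 < δ₀ ∧ ∀ n ≥ N, Metric.ball c₀ (3 * s) ⊆ (Ws n).carrier ∩ W.carrier ∧ Metric.ball d₀ (3 * s) ⊆ (Ws n).carrier ∩ W.carrier ∧ ∀ δ ∈ Set.Ioo (0 : ℝ) δ₀, ∀ c d : Literature.Probability.LatticeModels.Site 2, Literature.Probability.LatticeModels.meshPoint δ c ∈ Metric.ball c₀ s → Literature.Probability.LatticeModels.meshPoint δ d ∈ Metric.ball d₀ s → (Literature.Probability.LatticeModels.discreteDomainGraph (Ws n).carrier δ).Reachable c d ∧ (Literature.Probability.LatticeModels.discreteDomainGraph W.carrier δ).Reachable c d)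

/-- Alias of the statement of `stub_pinsJoinBulk`, keyed by the stub name. -/
abbrev stub_pinsJoinBulk : Prop :=
  ∀ (D : Literature.Probability.RandomPlanarGeometry.DobrushinDomain), (let IsWall : Literature.Probability.RandomPlanarGeometry.CurveClass ℂ → Literature.Probability.RandomPlanarGeometry.DobrushinDomain → Prop := fun η W => W.carrier ⊆ D.carrier ∧ W.pt 0 = D.pt 0 ∧ W.pt 1 = D.pt 1 ∧ frontier W.carrier = η.range ∪ D.arc 1; ∀ (ηs : ℕ → Literature.Probability.RandomPlanarGeometry.CurveClass ℂ) (η : Literature.Probability.RandomPlanarGeometry.CurveClass ℂ) (Ws : ℕ → Literature.Probability.RandomPlanarGeometry.DobrushinDomain) (W : Literature.Probability.RandomPlanarGeometry.DobrushinDomain), (∀ n, IsWall (ηs n) (Ws n)) → IsWall η W → η ∈ Literature.Probability.RandomPlanarGeometry.CurveClass.simple → Filter.Tendsto ηs Filter.atTop (nhds η) → ∀ (c₀ : ℂ) (s : ℝ), 0 < s → (∃ N : ℕ, ∀ n ≥ N, Metric.ball c₀ (2 * s) ⊆ (Ws n).carrier ∩ W.carrier) → ∃ ρ' : ℝ, 0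 < ρ' ∧ ∃ N : ℕ, ∃ δ₀ : ℝ, 0 < δ₀ ∧ ∀ n ≥ N, ∀ δ ∈ Set.Ioo (0 : ℝ) δ₀, ∀ x y c : Literature.Probability.LatticeModels.Site 2, dist (Literature.Probability.LatticeModels.meshPoint δ x) (D.pt 0) < ρ' → dist (Literature.Probability.LatticeModels.meshPoint δ y) (D.pt 1) < ρ' → Literature.Probability.LatticeModels.meshPoint δ c ∈ Metric.ball c₀ s → ((Literature.Probability.LatticeModels.discreteDomainGraph (Ws n).carrier δ).Reachable x y → (Literature.Probability.LatticeModels.discreteDomainGraph (Ws n).carrier δ).Reachable x c) ∧ ((Literature.Probability.LatticeModels.discreteDomainGraph W.carrier δ).Reachable x y → (Literature.Probability.LatticeModels.discreteDomainGraph W.carrier δ).Reachable x c))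

end __Registered

/-- **Composition** (kernel-checked, no `sorry` of its own): anchors at the nearest sites to the anchor
centres; the bulk stub joins them to each other in both graphs, the single-body stub joins the given pin
pairs to the anchor `c` in their respective graphs. [folklore] -/
theorem CommonPinsExist_of :
    __Registered.stub_commonBulk → __Registered.stub_pinsJoinBulk → CommonPinsExist := by
  intro hB hJ D
  dsimp only
  intro ηs η Ws W hWs hW hη hconv ρ hρ
  have hB1 := hB D
  dsimp only at hB1
  obtain ⟨s, hs, hsρ, c₀, d₀, hc₀, hd₀, N₁, δ₁, hδ₁, H₁⟩ := hB1 ηs η Ws W hWs hW hη hconv ρ hρ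
  have hc₀' : ∃ N : ℕ, ∀ n ≥ N, Metric.ball c₀ (2 * s) ⊆ (Ws n).carrier ∩ W.carrier :=
    ⟨N₁, fun n hn => (Metric.ball_subset_ball (by linarith)).trans (H₁ n hn).1⟩
  have hJ1 := hJ D
  dsimp only at hJ1
  obtain ⟨ρ', hρ', N₂, δ₂, hδ₂, H₂⟩ := hJ1 ηs η Ws W hWs hW hη hconv c₀ s hs hc₀'
  refine ⟨ρ', hρ', s, hs, max N₁ N₂, min δ₁ (min δ₂ s), lt_min hδ₁ (lt_min hδ₂ hs), ?_⟩
  intro n hn δ hδ x y x' y' hx hy hx' hy' hRn hRW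
  simp only [ge_iff_le, max_le_iff] at hn
  obtain ⟨hn₁, hn₂⟩ := hn
  obtain ⟨hδ0, hδ'⟩ := hδ
  simp only [lt_min_iff] at hδ'
  obtain ⟨hδ₁', hδ₂', hδs⟩ := hδ'
  -- the anchors: nearest lattice sites to the anchor centres
  set c := Literature.Probability.LatticeModels.nearestSite δ c₀ with hc_def
  set d := Literature.Probability.LatticeModels.nearestSite δ d₀ with hd_def
  have hcc : dist (Literature.Probability.LatticeModels.meshPoint δ c) c₀ < s :=
    (Literature.Probability.LatticeModels.dist_meshPoint_nearestSite_le hδ0 c₀).trans_lt hδs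
  have hdd : dist (Literature.Probability.LatticeModels.meshPoint δ d) d₀ < s :=
    (Literature.Probability.LatticeModels.dist_meshPoint_nearestSite_le hδ0 d₀).trans_lt hδs
  have hc_mem : Literature.Probability.LatticeModels.meshPoint δ c ∈ Metric.ball c₀ s := hcc
  have hd_mem : Literature.Probability.LatticeModels.meshPoint δ d ∈ Metric.ball d₀ s := hdd
  obtain ⟨hballc, hballd, Hcd⟩ := H₁ n hn₁
  obtain ⟨hRcdn, hRcdW⟩ := Hcd δ ⟨hδ0, hδ₁'⟩ c d hc_mem hd_mem
  have Jx := H₂ n hn₂ δ ⟨hδ0, hδ₂'⟩ x y c hx hy hc_mem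
  have Jx' := H₂ n hn₂ δ ⟨hδ0, hδ₂'⟩ x' y' c hx' hy' hc_mem
  refine ⟨c, d, ?_, ?_, ?_, ?_, Jx.1 hRn, hRcdn, Jx'.2 hRW, hRcdW⟩
  · calc dist (Literature.Probability.LatticeModels.meshPoint δ c) (D.pt 0)
          ≤ dist (Literature.Probability.LatticeModels.meshPoint δ c) c₀ + dist c₀ (D.pt 0) := dist_triangle _ _ _
      _ < s + ρ / 2 := add_lt_add hcc hc₀
      _ ≤ ρ := by linarith
  · calc dist (Literature.Probability.LatticeModels.meshPoint δ d) (D.pt 1)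
          ≤ dist (Literature.Probability.LatticeModels.meshPoint δ d) d₀ + dist d₀ (D.pt 1) := dist_triangle _ _ _
      _ < s + ρ / 2 := add_lt_add hdd hd₀
      _ ≤ ρ := by linarith
  · refine subset_trans ?_ hballc
    exact Metric.ball_subset_ball' (by linarith [hcc.le])
  · refine subset_trans ?_ hballd
    exact Metric.ball_subset_ball' (by linarith [hdd.le])

/-- WIRING CHECK (an `example`, so no pre-composed witness enters the environment). -/
example : CommonPinsExist := CommonPinsExist_of stub_commonBulk stub_pinsJoinBulk

end Summit.CriticalPhenomena.SAWScalingLimit.Cruxes.CommonPinsExist.Birth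

end
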